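import Summits.QuantumFields.BalabanUV.Beta.BorderJetWard

/-!
# `BalabanUV.Beta.RootedT2JetAdditive` — binder row D1, «GAUGE-LETTERS» (G3b): **THE ROOTED BORDER JET `T2At` IS ADDITIVE IN EACH BACKGROUND SLOT**
# (scalar fluctuation `upF W`) (β sub-cell, BINDER-OWNERS row D1 OWNER, lineage an2 gen 21)

HONEST FRAMING (cell charter, verbatim): «discharging BetaPertH makes Balaban's UV stability UNCONDITIONAL — a real
constructive-QFT result; it is NOT the continuum limit and NOT the Clay problem.»
HONEST DEPENDENCY: continuum YM on T⁴ ⇐ BetaPertH ∧ nine spine estimates (0/9 proved); BetaPertH ⇐ (D1) ∧ (D4) ∧ CAP+tail;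
G-an2-4 gates asym, D1 and NE2/3/4.
DERIVED cell leaf ([folklore] nested dual numbers), BY NAME over an3's 33H `RootedJetTwist` (`map_QjetLAt` = naturality of the rooted jet in the
letter algebra, `killHom`, `lineHom`, `liftT`), 33J `RootedT2JetDictionary` (`pr1`, `pr2`, `T2At_upF_neg_B/B′`), node 12 (`Tau`, `Ebg`, `Ebi`,
`T2At`) and G3 `BorderJetWard` (`c11_QjetAt_upF_zero_B/B′`).  No statement of Bałaban's papers, no `[cite:]`, no `Prop` fact; the `def`s are
[our object]s (two slot maps `ε ↦ τ₁`, `ε ↦ τ₂` and the `ε`-lifted letters).  The infrastructure the extraction G4-B needs to turn the jet Ward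
identity G3 `T2At_gauge` (background `(dδ_u)•D = Σ_κ (single (κ,u−e_κ) D − single (κ,u) D)`) into the Σ_κ of per-bond tables of an1's site law
(W2-B); discharges NO letter by itself; 0∕4 binders.  NOT D1, NOT `BetaPertH`, NOT continuum, NOT Clay.

METHOD (the «derivative trick» without computing the derivative): over `𝔸[ε]`, the letter `E♮ = ι(1 + εB₂) · Ê(B₁, B′)` maps under the SLOT
MAP `Ψ₁ : ε ↦ τ₁` to `Ebg (B₁ + B₂) B′` and under the KILL MAP `ε ↦ 0` to `Ebg B₁ B′`; since `Ψ₁ = kill + τ₁·ι(ε-part of c00) + τ₁τ₂·ι(ε-part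
of c01)`, `c11 Q(B₁ + B₂) = c11 Q(B₁) + (ε-part of c01 Q♮)`, and the `τ₁`-KILLING map `K₁` shows that `c01 Q♮` does not depend on `B₁`; at
`B₁ = 0` the remainder is `c11 Q(B₂)` (G3 `c11_QjetAt_upF_zero_B`, char ≠ 2).  Slot `τ₂` symmetrically.

WHAT: §1 `Ψ₁`, `Ψ₂`, `K₁`, `K₂` and their components; §2 the lifted letters and their images; §3 `c11_QjetAt_add_B`, `c11_QjetAt_add_B'`
(`(L:𝕜) ≠ 0` not needed; char ≠ 2); §4 **`T2At_add_B`**, `T2At_zero_B`, `T2At_neg_B`, `T2At_sub_B`, `T2At_sum_B` (and the `B′`-slot twins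
by `T2At_symm`).
Provenance: β sub-cell, unit beta-an2 gen 21, 2026-08-20 (v1); no existing file touched.
-/

namespace Summit.QuantumFields.BalabanUV.Beta.RootedT2JetAdditive

open Finset
open Literature.MathematicalPhysics.QuantumFieldTheory.Balaban1983to89
open Literature.MathematicalPhysics.QuantumFieldTheory.Balaban1983to89.Beta
open AffineAveraging (Form1)
open AveragingThirdJet (Tau Rho dmk fst_dmk snd_dmk dfst_mul dsnd_mul mapDual upF upF_apply Ebg Ebi)
open AveragingThirdJet.Tau (τ₁ τ₂ τ12 ι c00 c10 c01 c11 mk ext4)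
open AveragingMixedJetTables (QjetAt T2At T2At_symm)
open Summit.QuantumFields.BalabanUV.Beta.RootedJetReflection (QjetLAt QjetAt_eq_QjetLAt)
open Summit.QuantumFields.BalabanUV.Beta.RootedJetTwist (killHom lineHom liftT map_QjetLAt c00_killHom c10_killHom c01_killHom c11_killHom
  c00_lineHom c10_lineHom c01_lineHom c11_lineHom)
open Summit.QuantumFields.BalabanUV.Beta.RootedT2JetDictionary (pr1 pr2 fst_pr1 snd_pr1 fst_pr2 snd_pr2 T2At_upF_neg_B)
open Summit.QuantumFields.BalabanUV.Beta.BorderJetWard (c11_QjetAt_upF_zero_B c11_QjetAt_upF_zero_B')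

variable {𝕜 : Type*} [Field 𝕜] {d : ℕ} {𝔸 : Type*} [Ring 𝔸] [Algebra 𝕜 𝔸]

/-! ## §1 The slot maps `ε ↦ τ₁`, `ε ↦ τ₂` and the partial kill maps -/

/-- [our object] THE SLOT MAP `Ψ₁ : Tau (𝔸[ε]) → Tau 𝔸`, `ε ↦ τ₁`: `mk a b c e ↦ mk a₀ (b₀ + a₁) c₀ (e₀ + c₁)` — an algebra map because `τ₁` is
central of square zero. -/
def Ψ₁ : Tau (DualNumber 𝔸) →ₐ[𝕜] Tau 𝔸 where
  toFun q := Tau.mk (c00 q).fst ((c10 q).fst + (c00 q).snd) (c01 q).fst ((c11 q).fst + (c01 q).snd)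
  map_one' := ext4 (by simp) (by simp) (by simp) (by simp)
  map_mul' p q := ext4 (by simp)
    (by simp only [AveragingThirdJet.Tau.c10_mul, AveragingThirdJet.Tau.c00_mul, TrivSqZeroExt.fst_add, dfst_mul, dsnd_mul,
        AveragingThirdJet.Tau.c10_mk, AveragingThirdJet.Tau.c00_mk, mul_add, add_mul]; abel)
    (by simp)
    (by simp only [AveragingThirdJet.Tau.c11_mul, AveragingThirdJet.Tau.c01_mul, AveragingThirdJet.Tau.c00_mul, AveragingThirdJet.Tau.c10_mul,
        TrivSqZeroExt.fst_add, TrivSqZeroExt.snd_add, dfst_mul, dsnd_mul, AveragingThirdJet.Tau.c11_mk, AveragingThirdJet.Tau.c00_mk,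
        AveragingThirdJet.Tau.c10_mk, AveragingThirdJet.Tau.c01_mk, mul_add, add_mul]; abel)
  map_zero' := ext4 (by simp) (by simp) (by simp) (by simp)
  map_add' p q := ext4 (by simp) (by simp only [AveragingThirdJet.Tau.c10_add, AveragingThirdJet.Tau.c00_add, TrivSqZeroExt.fst_add,
      TrivSqZeroExt.snd_add, AveragingThirdJet.Tau.c10_mk]; abel) (by simp)
    (by simp only [AveragingThirdJet.Tau.c11_add, AveragingThirdJet.Tau.c01_add, TrivSqZeroExt.fst_add, TrivSqZeroExt.snd_add,
        AveragingThirdJet.Tau.c11_mk]; abel)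
  commutes' r := ext4 (by simp [Algebra.algebraMap_eq_smul_one]) (by simp [Algebra.algebraMap_eq_smul_one])
    (by simp [Algebra.algebraMap_eq_smul_one]) (by simp [Algebra.algebraMap_eq_smul_one])

/-- [our object] THE SLOT MAP `Ψ₂ : Tau (𝔸[ε]) → Tau 𝔸`, `ε ↦ τ₂`: `mk a b c e ↦ mk a₀ b₀ (c₀ + a₁) (e₀ + b₁)`. -/
def Ψ₂ : Tau (DualNumber 𝔸) →ₐ[𝕜] Tau 𝔸 where
  toFun q := Tau.mk (c00 q).fst (c10 q).fst ((c01 q).fst + (c00 q).snd) ((c11 q).fst + (c10 q).snd)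
  map_one' := ext4 (by simp) (by simp) (by simp) (by simp)
  map_mul' p q := ext4 (by simp) (by simp)
    (by simp only [AveragingThirdJet.Tau.c01_mul, AveragingThirdJet.Tau.c00_mul, TrivSqZeroExt.fst_add, dfst_mul, dsnd_mul,
        AveragingThirdJet.Tau.c01_mk, AveragingThirdJet.Tau.c00_mk, mul_add, add_mul]; abel)
    (by simp only [AveragingThirdJet.Tau.c11_mul, AveragingThirdJet.Tau.c01_mul, AveragingThirdJet.Tau.c00_mul, AveragingThirdJet.Tau.c10_mul,
        TrivSqZeroExt.fst_add, TrivSqZeroExt.snd_add, dfst_mul, dsnd_mul, AveragingThirdJet.Tau.c11_mk, AveragingThirdJet.Tau.c00_mk,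
        AveragingThirdJet.Tau.c10_mk, AveragingThirdJet.Tau.c01_mk, mul_add, add_mul]; abel)
  map_zero' := ext4 (by simp) (by simp) (by simp) (by simp)
  map_add' p q := ext4 (by simp) (by simp) (by simp only [AveragingThirdJet.Tau.c01_add, AveragingThirdJet.Tau.c00_add, TrivSqZeroExt.fst_add,
      TrivSqZeroExt.snd_add, AveragingThirdJet.Tau.c01_mk]; abel)
    (by simp only [AveragingThirdJet.Tau.c11_add, AveragingThirdJet.Tau.c10_add, TrivSqZeroExt.fst_add, TrivSqZeroExt.snd_add,
        AveragingThirdJet.Tau.c11_mk]; abel)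
  commutes' r := ext4 (by simp [Algebra.algebraMap_eq_smul_one]) (by simp [Algebra.algebraMap_eq_smul_one])
    (by simp [Algebra.algebraMap_eq_smul_one]) (by simp [Algebra.algebraMap_eq_smul_one])

/-- [folklore] `c11 ∘ Ψ₁`. -/
@[simp] theorem c11_Ψ₁ (q : Tau (DualNumber 𝔸)) : c11 (Ψ₁ (𝕜 := 𝕜) q) = (c11 q).fst + (c01 q).snd := rfl
/-- [folklore] `c11 ∘ Ψ₂`. -/
@[simp] theorem c11_Ψ₂ (q : Tau (DualNumber 𝔸)) : c11 (Ψ₂ (𝕜 := 𝕜) q) = (c11 q).fst + (c10 q).snd := rfl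
/-- [folklore] -/
@[simp] theorem c00_Ψ₁ (q : Tau (DualNumber 𝔸)) : c00 (Ψ₁ (𝕜 := 𝕜) q) = (c00 q).fst := rfl
/-- [folklore] -/
@[simp] theorem c10_Ψ₁ (q : Tau (DualNumber 𝔸)) : c10 (Ψ₁ (𝕜 := 𝕜) q) = (c10 q).fst + (c00 q).snd := rfl
/-- [folklore] -/
@[simp] theorem c01_Ψ₁ (q : Tau (DualNumber 𝔸)) : c01 (Ψ₁ (𝕜 := 𝕜) q) = (c01 q).fst := rfl
/-- [folklore] -/
@[simp] theorem c00_Ψ₂ (q : Tau (DualNumber 𝔸)) : c00 (Ψ₂ (𝕜 := 𝕜) q) = (c00 q).fst := rfl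
/-- [folklore] -/
@[simp] theorem c10_Ψ₂ (q : Tau (DualNumber 𝔸)) : c10 (Ψ₂ (𝕜 := 𝕜) q) = (c10 q).fst := rfl
/-- [folklore] -/
@[simp] theorem c01_Ψ₂ (q : Tau (DualNumber 𝔸)) : c01 (Ψ₂ (𝕜 := 𝕜) q) = (c01 q).fst + (c00 q).snd := rfl

section Kill

variable {R : Type*} [Ring R] [Algebra 𝕜 R]

/-- [our object] THE `τ₁`-KILLING MAP `K₁ : mk a b c e ↦ mk a c 0 0` (kills `τ₁`, renames `τ₂ ↦ τ₁`; 33J `pr2` then 33H `lineHom`). -/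
def K₁ : Tau R →ₐ[𝕜] Tau R := (lineHom (𝕜 := 𝕜)).comp (pr2 (𝕜 := 𝕜))

/-- [our object] THE `τ₂`-KILLING MAP `K₂ : mk a b c e ↦ mk a b 0 0` (33J `pr1` then 33H `lineHom`). -/
def K₂ : Tau R →ₐ[𝕜] Tau R := (lineHom (𝕜 := 𝕜)).comp (pr1 (𝕜 := 𝕜))

/-- [folklore] Components of `K₁`. -/
@[simp] theorem c00_K₁ (q : Tau R) : c00 (K₁ (𝕜 := 𝕜) q) = c00 q := rfl
/-- [folklore] -/
@[simp] theorem c10_K₁ (q : Tau R) : c10 (K₁ (𝕜 := 𝕜) q) = c01 q := rfl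
/-- [folklore] -/
@[simp] theorem c01_K₁ (q : Tau R) : c01 (K₁ (𝕜 := 𝕜) q) = 0 := rfl
/-- [folklore] -/
@[simp] theorem c11_K₁ (q : Tau R) : c11 (K₁ (𝕜 := 𝕜) q) = 0 := rfl
/-- [folklore] Components of `K₂`. -/
@[simp] theorem c00_K₂ (q : Tau R) : c00 (K₂ (𝕜 := 𝕜) q) = c00 q := rfl
/-- [folklore] -/
@[simp] theorem c10_K₂ (q : Tau R) : c10 (K₂ (𝕜 := 𝕜) q) = c10 q := rfl
/-- [folklore] -/
@[simp] theorem c01_K₂ (q : Tau R) : c01 (K₂ (𝕜 := 𝕜) q) = 0 := rfl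
/-- [folklore] -/
@[simp] theorem c11_K₂ (q : Tau R) : c11 (K₂ (𝕜 := 𝕜) q) = 0 := rfl

end Kill

/-! ## §2 The `ε`-lifted letters and their images -/

/-- [our object] The constant lift of an `𝔸`-valued letter to `𝔸[ε]`. -/
def Wl (W : Form1 d 𝔸) : Form1 d (DualNumber 𝔸) := fun κ x => dmk (W κ x) 0

/-- [our object] Slot 1, forward: `E♮ = ι(1 + εB₂) · Ê(B₁, B′)`. -/
def E1 (B₁ B₂ B' : Form1 d 𝔸) : Form1 d (Tau (DualNumber 𝔸)) := fun κ x => ι (dmk 1 (B₂ κ x)) * liftT (Ebg B₁ B' κ x)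

/-- [our object] Slot 1, backward: `Ē♮ = Ē̂(B₁, B′) · ι(1 − εB₂)`. -/
def Eb1 (B₁ B₂ B' : Form1 d 𝔸) : Form1 d (Tau (DualNumber 𝔸)) := fun κ x => liftT (Ebi B₁ B' κ x) * ι (dmk 1 (-B₂ κ x))

/-- [our object] Slot 1 shadow (no `B₁`): `ι(1 + εB₂) · Ê(B′, 0)` (the `τ₂`-letter moved to the `τ₁`-line by `K₁`). -/
def S1 (B₂ B' : Form1 d 𝔸) : Form1 d (Tau (DualNumber 𝔸)) := fun κ x => ι (dmk 1 (B₂ κ x)) * liftT (Ebg B' 0 κ x)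

/-- [our object] -/
def Sb1 (B₂ B' : Form1 d 𝔸) : Form1 d (Tau (DualNumber 𝔸)) := fun κ x => liftT (Ebi B' 0 κ x) * ι (dmk 1 (-B₂ κ x))

/-- [our object] Slot 2, forward: `E♮ = Ê(B, B′₁) · ι(1 + εB′₂)`. -/
def E2 (B B'₁ B'₂ : Form1 d 𝔸) : Form1 d (Tau (DualNumber 𝔸)) := fun κ x => liftT (Ebg B B'₁ κ x) * ι (dmk 1 (B'₂ κ x))

/-- [our object] Slot 2, backward: `Ē♮ = ι(1 − εB′₂) · Ē̂(B, B′₁)`. -/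
def Eb2 (B B'₁ B'₂ : Form1 d 𝔸) : Form1 d (Tau (DualNumber 𝔸)) := fun κ x => ι (dmk 1 (-B'₂ κ x)) * liftT (Ebi B B'₁ κ x)

/-- [our object] Slot 2 shadow (no `B′₁`). -/
def S2 (B B'₂ : Form1 d 𝔸) : Form1 d (Tau (DualNumber 𝔸)) := fun κ x => liftT (Ebg B 0 κ x) * ι (dmk 1 (B'₂ κ x))

/-- [our object] -/
def Sb2 (B B'₂ : Form1 d 𝔸) : Form1 d (Tau (DualNumber 𝔸)) := fun κ x => ι (dmk 1 (-B'₂ κ x)) * liftT (Ebi B 0 κ x)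

section Images

variable (W B₁ B₂ B' : Form1 d 𝔸)

/-- [folklore] `Ψ₁ ∘ upF Wl = upF W`. -/
theorem Ψ₁_upF : (fun κ x => Ψ₁ (𝕜 := 𝕜) (upF (Wl W) κ x)) = upF W := by
  funext κ x; exact ext4 (by simp [Wl]) (by simp [Wl]) (by simp [Wl]) (by simp [Wl])
/-- [folklore] `Ψ₂ ∘ upF Wl = upF W`. -/
theorem Ψ₂_upF : (fun κ x => Ψ₂ (𝕜 := 𝕜) (upF (Wl W) κ x)) = upF W := by
  funext κ x; exact ext4 (by simp [Wl]) (by simp [Wl]) (by simp [Wl]) (by simp [Wl])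
/-- [folklore] `kill ∘ upF Wl = upF W`. -/
theorem kill_upF : (fun κ x => killHom (𝕜 := 𝕜) (upF (Wl W) κ x)) = upF W := by
  funext κ x; exact ext4 (by simp [Wl]) (by simp [Wl]) (by simp [Wl]) (by simp [Wl])
/-- [folklore] `K₁ ∘ upF Wl = upF Wl`. -/
theorem K₁_upF : (fun κ x => K₁ (𝕜 := 𝕜) (upF (Wl W) κ x)) = upF (Wl W) := by
  funext κ x; exact ext4 rfl rfl rfl rfl
/-- [folklore] `K₂ ∘ upF Wl = upF Wl`. -/
theorem K₂_upF : (fun κ x => K₂ (𝕜 := 𝕜) (upF (Wl W) κ x)) = upF (Wl W) := by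
  funext κ x; exact ext4 rfl rfl rfl rfl

/-- [folklore] `dmk 0 0 = 0`. -/
theorem dmk_zero_zero {R : Type*} [Ring R] : (dmk (0 : R) 0 : DualNumber R) = 0 := rfl

/-- [folklore] **`Ψ₁ E♮ = Ebg (B₁ + B₂) B′`** (`(1 + τ₁B₂)(1 + τ₁B₁) = 1 + τ₁(B₁ + B₂)`). -/
theorem Ψ₁_E1 : (fun κ x => Ψ₁ (𝕜 := 𝕜) (E1 B₁ B₂ B' κ x)) = Ebg (B₁ + B₂) B' := by
  funext κ x
  exact ext4 (by simp [E1, Ebg, liftT]) (by simp [E1, Ebg, liftT]) (by simp [E1, Ebg, liftT]) (by simp [E1, Ebg, liftT, add_mul])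
/-- [folklore] **`Ψ₁ Ē♮ = Ebi (B₁ + B₂) B′`**. -/
theorem Ψ₁_Eb1 : (fun κ x => Ψ₁ (𝕜 := 𝕜) (Eb1 B₁ B₂ B' κ x)) = Ebi (B₁ + B₂) B' := by
  funext κ x
  exact ext4 (by simp [Eb1, Ebi, liftT]) (by simp [Eb1, Ebi, liftT]) (by simp [Eb1, Ebi, liftT]) (by simp [Eb1, Ebi, liftT, mul_add])
/-- [folklore] `kill E♮ = Ebg B₁ B′`. -/
theorem kill_E1 : (fun κ x => killHom (𝕜 := 𝕜) (E1 B₁ B₂ B' κ x)) = Ebg B₁ B' := by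
  funext κ x
  exact ext4 (by simp [E1, Ebg, liftT]) (by simp [E1, Ebg, liftT]) (by simp [E1, Ebg, liftT]) (by simp [E1, Ebg, liftT])
/-- [folklore] `kill Ē♮ = Ebi B₁ B′`. -/
theorem kill_Eb1 : (fun κ x => killHom (𝕜 := 𝕜) (Eb1 B₁ B₂ B' κ x)) = Ebi B₁ B' := by
  funext κ x
  exact ext4 (by simp [Eb1, Ebi, liftT]) (by simp [Eb1, Ebi, liftT]) (by simp [Eb1, Ebi, liftT]) (by simp [Eb1, Ebi, liftT])
/-- [folklore] `K₁ E♮ = S1 B₂ B′` (no `B₁`). -/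
theorem K₁_E1 : (fun κ x => K₁ (𝕜 := 𝕜) (E1 B₁ B₂ B' κ x)) = S1 B₂ B' := by
  funext κ x
  exact ext4 (by simp [E1, S1, Ebg, liftT]) (by simp [E1, S1, Ebg, liftT]) (by simp [E1, S1, Ebg, liftT, dmk_zero_zero])
    (by simp [E1, S1, Ebg, liftT, dmk_zero_zero])
/-- [folklore] `K₁ Ē♮ = Sb1 B₂ B′`. -/
theorem K₁_Eb1 : (fun κ x => K₁ (𝕜 := 𝕜) (Eb1 B₁ B₂ B' κ x)) = Sb1 B₂ B' := by
  funext κ x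
  exact ext4 (by simp [Eb1, Sb1, Ebi, liftT]) (by simp [Eb1, Sb1, Ebi, liftT]) (by simp [Eb1, Sb1, Ebi, liftT, dmk_zero_zero])
    (by simp [Eb1, Sb1, Ebi, liftT, dmk_zero_zero])

/-- [folklore] **`Ψ₂ E♮ = Ebg B (B′₁ + B′₂)`**. -/
theorem Ψ₂_E2 : (fun κ x => Ψ₂ (𝕜 := 𝕜) (E2 B₁ B₂ B' κ x)) = Ebg B₁ (B₂ + B') := by
  funext κ x
  exact ext4 (by simp [E2, Ebg, liftT]) (by simp [E2, Ebg, liftT]) (by simp [E2, Ebg, liftT]; abel)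
    (by simp [E2, Ebg, liftT, mul_add]; abel)
/-- [folklore] **`Ψ₂ Ē♮ = Ebi B (B′₁ + B′₂)`**. -/
theorem Ψ₂_Eb2 : (fun κ x => Ψ₂ (𝕜 := 𝕜) (Eb2 B₁ B₂ B' κ x)) = Ebi B₁ (B₂ + B') := by
  funext κ x
  exact ext4 (by simp [Eb2, Ebi, liftT]) (by simp [Eb2, Ebi, liftT]) (by simp [Eb2, Ebi, liftT]; abel)
    (by simp [Eb2, Ebi, liftT, add_mul])
/-- [folklore] `kill E♮ = Ebg B B′₁`. -/
theorem kill_E2 : (fun κ x => killHom (𝕜 := 𝕜) (E2 B₁ B₂ B' κ x)) = Ebg B₁ B₂ := by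
  funext κ x
  exact ext4 (by simp [E2, Ebg, liftT]) (by simp [E2, Ebg, liftT]) (by simp [E2, Ebg, liftT]) (by simp [E2, Ebg, liftT])
/-- [folklore] `kill Ē♮ = Ebi B B′₁`. -/
theorem kill_Eb2 : (fun κ x => killHom (𝕜 := 𝕜) (Eb2 B₁ B₂ B' κ x)) = Ebi B₁ B₂ := by
  funext κ x
  exact ext4 (by simp [Eb2, Ebi, liftT]) (by simp [Eb2, Ebi, liftT]) (by simp [Eb2, Ebi, liftT]) (by simp [Eb2, Ebi, liftT])
/-- [folklore] `K₂ E♮ = S2 B B′₂` (no `B′₁`). -/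
theorem K₂_E2 : (fun κ x => K₂ (𝕜 := 𝕜) (E2 B₁ B₂ B' κ x)) = S2 B₁ B' := by
  funext κ x
  exact ext4 (by simp [E2, S2, Ebg, liftT]) (by simp [E2, S2, Ebg, liftT]) (by simp [E2, S2, Ebg, liftT, dmk_zero_zero])
    (by simp [E2, S2, Ebg, liftT, dmk_zero_zero])
/-- [folklore] `K₂ Ē♮ = Sb2 B B′₂`. -/
theorem K₂_Eb2 : (fun κ x => K₂ (𝕜 := 𝕜) (Eb2 B₁ B₂ B' κ x)) = Sb2 B₁ B' := by
  funext κ x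
  exact ext4 (by simp [Eb2, Sb2, Ebi, liftT]) (by simp [Eb2, Sb2, Ebi, liftT]) (by simp [Eb2, Sb2, Ebi, liftT, dmk_zero_zero])
    (by simp [Eb2, Sb2, Ebi, liftT, dmk_zero_zero])

end Images

/-! ## §3 Additivity of `c11 Q^ρ(upF W; ·, ·)` in each background slot -/

section Additivity

variable (ρ : Fin d → ℤ) (W : Form1 d 𝔸) (L : ℕ) (μ : Fin d) (y : Fin d → ℤ)

/-- [folklore] **SLOT 1, WITH REMAINDER**: `c11 Q(B₁ + B₂, B′) = c11 Q(B₁, B′) + ε-part(c10 Q♭)`, `Q♭` the jet of the `B₁`-FREE shadow letters. -/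
theorem c11_QjetAt_add_B_aux (B₁ B₂ B' : Form1 d 𝔸) :
    c11 (QjetAt 𝕜 ρ (upF W) (B₁ + B₂) B' L μ y)
      = c11 (QjetAt 𝕜 ρ (upF W) B₁ B' L μ y) + (c10 (QjetLAt 𝕜 ρ (upF (Wl W)) (S1 B₂ B') (Sb1 B₂ B') L μ y)).snd := by
  have h1 := map_QjetLAt (R := DualNumber 𝔸) (R' := 𝔸) (Ψ₁ (𝕜 := 𝕜)) ρ (upF (Wl W)) (E1 B₁ B₂ B') (Eb1 B₁ B₂ B') L μ y
  have h2 := map_QjetLAt (R := DualNumber 𝔸) (R' := 𝔸) (killHom (𝕜 := 𝕜)) ρ (upF (Wl W)) (E1 B₁ B₂ B') (Eb1 B₁ B₂ B') L μ y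
  have h3 := map_QjetLAt (R := DualNumber 𝔸) (R' := DualNumber 𝔸) (K₁ (𝕜 := 𝕜)) ρ (upF (Wl W)) (E1 B₁ B₂ B') (Eb1 B₁ B₂ B') L μ y
  rw [Ψ₁_upF, Ψ₁_E1, Ψ₁_Eb1, ← QjetAt_eq_QjetLAt] at h1
  rw [kill_upF, kill_E1, kill_Eb1, ← QjetAt_eq_QjetLAt] at h2
  rw [K₁_upF, K₁_E1, K₁_Eb1] at h3
  rw [← h1, ← h2, ← h3, c11_Ψ₁, c11_killHom, c10_K₁]

/-- [folklore] **SLOT 2, WITH REMAINDER**. -/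
theorem c11_QjetAt_add_B'_aux (B B'₁ B'₂ : Form1 d 𝔸) :
    c11 (QjetAt 𝕜 ρ (upF W) B (B'₁ + B'₂) L μ y)
      = c11 (QjetAt 𝕜 ρ (upF W) B B'₁ L μ y) + (c10 (QjetLAt 𝕜 ρ (upF (Wl W)) (S2 B B'₂) (Sb2 B B'₂) L μ y)).snd := by
  have h1 := map_QjetLAt (R := DualNumber 𝔸) (R' := 𝔸) (Ψ₂ (𝕜 := 𝕜)) ρ (upF (Wl W)) (E2 B B'₁ B'₂) (Eb2 B B'₁ B'₂) L μ y
  have h2 := map_QjetLAt (R := DualNumber 𝔸) (R' := 𝔸) (killHom (𝕜 := 𝕜)) ρ (upF (Wl W)) (E2 B B'₁ B'₂) (Eb2 B B'₁ B'₂) L μ y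
  have h3 := map_QjetLAt (R := DualNumber 𝔸) (R' := DualNumber 𝔸) (K₂ (𝕜 := 𝕜)) ρ (upF (Wl W)) (E2 B B'₁ B'₂) (Eb2 B B'₁ B'₂) L μ y
  rw [Ψ₂_upF, Ψ₂_E2, Ψ₂_Eb2, ← QjetAt_eq_QjetLAt] at h1
  rw [kill_upF, kill_E2, kill_Eb2, ← QjetAt_eq_QjetLAt] at h2
  rw [K₂_upF, K₂_E2, K₂_Eb2] at h3
  rw [← h1, ← h2, ← h3, c11_Ψ₂, c11_killHom, c10_K₂]

variable (h2 : (2 : 𝕜) ≠ 0)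
include h2

/-- [folklore] **ADDITIVITY OF `c11 Q^ρ(upF W; ·, B′)` IN THE `τ₁`-BACKGROUND** (char ≠ 2). -/
theorem c11_QjetAt_add_B (B₁ B₂ B' : Form1 d 𝔸) :
    c11 (QjetAt 𝕜 ρ (upF W) (B₁ + B₂) B' L μ y) = c11 (QjetAt 𝕜 ρ (upF W) B₁ B' L μ y) + c11 (QjetAt 𝕜 ρ (upF W) B₂ B' L μ y) := by
  have e := c11_QjetAt_add_B_aux (𝕜 := 𝕜) ρ W L μ y 0 B₂ B'
  rw [zero_add, c11_QjetAt_upF_zero_B h2, zero_add] at e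
  rw [c11_QjetAt_add_B_aux, e]

/-- [folklore] **ADDITIVITY OF `c11 Q^ρ(upF W; B, ·)` IN THE `τ₂`-BACKGROUND** (char ≠ 2). -/
theorem c11_QjetAt_add_B' (B B'₁ B'₂ : Form1 d 𝔸) :
    c11 (QjetAt 𝕜 ρ (upF W) B (B'₁ + B'₂) L μ y) = c11 (QjetAt 𝕜 ρ (upF W) B B'₁ L μ y) + c11 (QjetAt 𝕜 ρ (upF W) B B'₂ L μ y) := by
  have e := c11_QjetAt_add_B'_aux (𝕜 := 𝕜) ρ W L μ y B 0 B'₂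
  rw [zero_add, c11_QjetAt_upF_zero_B' h2, zero_add] at e
  rw [c11_QjetAt_add_B'_aux, e]

/-! ## §4 Additivity of `T2At ρ (upF W)` in the first background (the second by `T2At_symm`) -/

/-- [folklore] **`T2At ρ (upF W)` IS ADDITIVE IN ITS FIRST BACKGROUND.** -/
theorem T2At_add_B (B₁ B₂ B' : Form1 d 𝔸) :
    T2At 𝕜 ρ (upF W) (B₁ + B₂) B' L μ y = T2At 𝕜 ρ (upF W) B₁ B' L μ y + T2At 𝕜 ρ (upF W) B₂ B' L μ y := by
  simp only [T2At, c11_QjetAt_add_B ρ W L μ y h2, c11_QjetAt_add_B' ρ W L μ y h2]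
  abel

/-- [folklore] … and in its second background. -/
theorem T2At_add_B' (B B'₁ B'₂ : Form1 d 𝔸) :
    T2At 𝕜 ρ (upF W) B (B'₁ + B'₂) L μ y = T2At 𝕜 ρ (upF W) B B'₁ L μ y + T2At 𝕜 ρ (upF W) B B'₂ L μ y := by
  rw [T2At_symm (𝕜 := 𝕜) ρ (upF W) (B'₁ + B'₂) B L μ y, T2At_add_B ρ W L μ y h2, ← T2At_symm (𝕜 := 𝕜) ρ (upF W) B'₁ B L μ y,
    ← T2At_symm (𝕜 := 𝕜) ρ (upF W) B'₂ B L μ y]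

/-- [folklore] `T2At ρ (upF W) 0 B′ = 0`. -/
theorem T2At_zero_B (B' : Form1 d 𝔸) : T2At 𝕜 ρ (upF W) 0 B' L μ y = 0 := by
  rw [T2At, c11_QjetAt_upF_zero_B h2, c11_QjetAt_upF_zero_B' h2, add_zero]

/-- [folklore] `T2At ρ (upF W)` is subtractive in its first background. -/
theorem T2At_sub_B (B₁ B₂ B' : Form1 d 𝔸) :
    T2At 𝕜 ρ (upF W) (B₁ - B₂) B' L μ y = T2At 𝕜 ρ (upF W) B₁ B' L μ y - T2At 𝕜 ρ (upF W) B₂ B' L μ y := by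
  rw [sub_eq_add_neg, T2At_add_B ρ W L μ y h2, T2At_upF_neg_B, ← sub_eq_add_neg]

/-- [folklore] `T2At ρ (upF W)` of a finite sum of first backgrounds. -/
theorem T2At_sum_B {ι' : Type*} (s : Finset ι') (B : ι' → Form1 d 𝔸) (B' : Form1 d 𝔸) :
    T2At 𝕜 ρ (upF W) (∑ i ∈ s, B i) B' L μ y = ∑ i ∈ s, T2At 𝕜 ρ (upF W) (B i) B' L μ y := by
  classical
  induction s using Finset.induction_on with
  | empty => rw [Finset.sum_empty, Finset.sum_empty, T2At_zero_B ρ W L μ y h2]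
  | insert i s hi ih => rw [Finset.sum_insert hi, Finset.sum_insert hi, T2At_add_B ρ W L μ y h2, ih]

end Additivity

end Summit.QuantumFields.BalabanUV.Beta.RootedT2JetAdditive
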